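import Summits.BirchSwinnertonDyer.BirchSwinnertonDyer.Theorems.GenusKolyvaginAtTwoGenusPrimitiveSupplyAtTwoGenusField
import Summits.BirchSwinnertonDyer.BirchSwinnertonDyer.Theorems.GenusKolyvaginAtTwoGenusPrimitiveSupplyAtTwoMultiGenusField

/-!
# Route `GenusKolyvaginAtTwo`, crux `GenusPrimitiveSupplyAtTwo` (stmt-BirchSwinnertonDyer-22136), line `genus-supply`:
# the GENUS-CHARACTER DECOMPOSITION `2^r · Z_n = Σ_{m ∣ n} Y_m` at composite level, and the composite-level divisibility criteria

Lead prover seat bsd-line-gk2-p1 (g3). Frame of `…MultiGenusField`: `n` square-free of Kolyvagin primes at `2` (`r` of them),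
`θ_ℓ = √ℓ* ∈ K[n]`, `𝒢_n = Gal(K[n]/K)` (enumerated by a finite `G`), `T = {g ∈ 𝒢_n : gθ_ℓ = θ_ℓ ∀ℓ} = Gal(K[n]/F_n)`,
`F_n = K(√ℓ₁*,…,√ℓ_r*)`, `Z_n = Σ_{g∈T} g·y(n)` the multi-genus trace (landed: `P(n) ∈ 2E(K[n]) ⟺ Z_n ∈ 2E(K[n])`,
`heegner_exists_two_zsmul_eq_derivedPoint_iff_multiGenusTrace`). The characters of `𝒢_n/T ≅ (ℤ/2)^r` are the genus characters
`χ_M(g) = ∏_{ℓ ∈ M} (gθ_ℓ/θ_ℓ)`, `M ⊆ {ℓ ∣ n}` (`χ_M ↔ K(√m*)`, `m = ∏ M`); their components of the orbit sum are the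
GENUS-CHARACTER POINTS `Y_M := Σ_{g ∈ 𝒢_n} χ_M(g) g·y(n) ∈ E(K[n])^{χ_M}` (by the norm relations `Y_M = A(n/m)·Y_m`,
`A(k) = ∏_{ℓ∣k} a_ℓ`, `Y_m` the Heegner point of the ring class character of conductor `m` — the Gross–Zagier datum of the genus twist
`E^{(m*)}/K`; `Y_∅ = A(n)·y_K`). This file proves, as theorems about points (the algebraic skeleton of the cell's U-LEDGER v1 §5):
* §1–§2 (abstract, any group acting on an abelian group) character orthogonality on `(ℤ/2)^r` and
  **`2^r · Z = Σ_{M ⊆ P} Y_M`** (`two_pow_smul_fixSum_eq_sum_components`);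
* §2 the divisibility criteria: if EVERY component `Y_M ∈ 2^{r+1}·A` then `Z ∈ 2·A` (`A` without `2`-torsion); if every component
  but `Y_{M₀}` is in `2^{r+1}·A` then `Z ∈ 2A ⟺ Y_{M₀} ∈ 2^{r+1}A`;
* §3 (Heegner frame) **`2^r · Z_n = Σ_M Y_M` in `E(K[n])`**, hence: (R1-mechanism) «every genus component `2^{r+1}`-divisible ⟹
  `P(n) ∈ 2E(K[n])` — the level `n` certifies nothing»; (R2-mechanism) «all components but one `2^{r+1}`-divisible ⟹
  (`P(n) ∈ 2E(K[n]) ⟺` that component is `2^{r+1}`-divisible)». At `r = 1` these are `…ExactnessCriterion` §2 (`Y_∅ = a_ℓ y_K′`,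
  `Y_{ℓ} = Y_χ`).
READING. On the habitat the BSD-side ledger predicts the `2`-adic valuation of each `Y_M` in its own `χ_M`-lattice (U-LEDGER (♣));
the theorems here are what turns those predictions into predictions about the crux's certificate — in particular (R1): with Gross-form
primes on `Δ_E > 0` every `Y_M`, `M ≠ ∅`, carries `≥ r + 1` twos and `Y_∅ = A(n)·y_K` carries `≥ r + M₀`, so no level certifies
once `M₀ ≥ 1`. Helper (`--supports stmt-BirchSwinnertonDyer-22136`); the crux stays OPEN; BSD is not proved by any of this.
-/

set_option linter.dupNamespace false -- tree convention: `Summit.BirchSwinnertonDyer.BirchSwinnertonDyer.Theorems` (summit = sub-problem)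

noncomputable section

open scoped Classical

namespace Summit.BirchSwinnertonDyer.BirchSwinnertonDyer.Theorems.GenusKoly

open Finset NumberField WeierstrassCurve Literature.NumberTheory.EllipticCurves
  Literature.NumberTheory.EllipticCurves.ModularForms

/-! ## §1 Character orthogonality on `(ℤ/2)^r`, as a sum over subsets -/

section Orthogonality

/-- **`Σ_{M ⊆ P} ∏_{ℓ ∈ M} ε_ℓ = ∏_{ℓ ∈ P} (ε_ℓ + 1)`** (expand the product). [folklore] -/
theorem sum_powerset_prod_eq_prod_add_one (P : Finset ℕ) (ε : ℕ → ℤ) :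
    ∑ M ∈ P.powerset, ∏ ℓ ∈ M, ε ℓ = ∏ ℓ ∈ P, (ε ℓ + 1) := by
  rw [Finset.prod_add]
  simp

/-- **Orthogonality**: for signs `ε_ℓ ∈ {±1}`, `∏_{ℓ ∈ P} (ε_ℓ + 1) = 2^{#P}` if every `ε_ℓ = 1`, and `0` otherwise — the sum of all
characters of `(ℤ/2)^r` evaluated at the element with coordinates `ε`. [folklore] -/
theorem prod_add_one_eq_ite (P : Finset ℕ) (ε : ℕ → ℤ) (hε : ∀ ℓ ∈ P, ε ℓ = 1 ∨ ε ℓ = -1) :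
    ∏ ℓ ∈ P, (ε ℓ + 1) = if ∀ ℓ ∈ P, ε ℓ = 1 then (2 : ℤ) ^ P.card else 0 := by
  split_ifs with h
  · rw [Finset.prod_congr rfl (fun ℓ hℓ ↦ by rw [h ℓ hℓ]), Finset.prod_const]
    norm_num
  · simp only [not_forall] at h
    obtain ⟨ℓ, hℓ, hne⟩ := h
    exact Finset.prod_eq_zero hℓ (by rw [(hε ℓ hℓ).resolve_left hne]; norm_num)

end Orthogonality

/-! ## §2 Abstract: `2^r · (fixed sum) = Σ_M (character component)`, and the divisibility criteria -/

section Abstract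

variable {𝒢 : Type*} [Group 𝒢] {A : Type*} [AddCommGroup A] (act : 𝒢 →* AddMonoid.End A)

omit [Group 𝒢] in
/-- **`2^r · Σ_{g ∈ G, g fixes every θ_ℓ} g·y = Σ_{M ⊆ P} Σ_{g ∈ G} χ_M(g) · g·y`**, `χ_M(g) = ∏_{ℓ∈M} (±1 according as g fixes θ_ℓ)`
— for ANY finite set `G` of group elements, any finite index set `P` (`r = #P`) and any «fixes» predicate: pure character
orthogonality (§1) summed against the orbit. [folklore] -/
theorem two_pow_smul_fixSum_eq_sum_components [Monoid 𝒢] (act : 𝒢 →* AddMonoid.End A) (G : Finset 𝒢) (P : Finset ℕ)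
    (fix : ℕ → 𝒢 → Prop) [∀ ℓ g, Decidable (fix ℓ g)] (y : A) :
    ((2 : ℤ) ^ P.card) • ∑ g ∈ G.filter (fun g ↦ ∀ ℓ ∈ P, fix ℓ g), act g y =
      ∑ M ∈ P.powerset, ∑ g ∈ G, (∏ ℓ ∈ M, (if fix ℓ g then (1 : ℤ) else -1)) • act g y := by
  rw [Finset.sum_comm, Finset.smul_sum, Finset.sum_filter]
  refine Finset.sum_congr rfl fun g _ ↦ ?_
  rw [← Finset.sum_smul, sum_powerset_prod_eq_prod_add_one,
    prod_add_one_eq_ite P _ (fun ℓ _ ↦ by by_cases h : fix ℓ g <;> simp [h])]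
  have key : (∀ ℓ ∈ P, (if fix ℓ g then (1 : ℤ) else -1) = 1) ↔ ∀ ℓ ∈ P, fix ℓ g := by
    refine forall₂_congr fun ℓ _ ↦ ?_
    by_cases h : fix ℓ g <;> simp [h]
  by_cases hg : ∀ ℓ ∈ P, fix ℓ g
  · rw [if_pos hg, if_pos (key.mpr hg)]
  · rw [if_neg hg, if_neg (mt key.mp hg), zero_smul]

omit [Group 𝒢] in
/-- `2^k`-torsion-freeness from `2`-torsion-freeness. [folklore] -/
theorem eq_zero_of_two_pow_smul_eq_zero (htors : ∀ Q : A, (2 : ℤ) • Q = 0 → Q = 0) (k : ℕ) (Q : A)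
    (hQ : ((2 : ℤ) ^ k) • Q = 0) : Q = 0 := by
  induction k generalizing Q with
  | zero => simpa using hQ
  | succ k ih =>
    have h : (2 : ℤ) • (((2 : ℤ) ^ k) • Q) = 0 := by rw [smul_smul, ← pow_succ', hQ]
    exact ih Q (htors _ h)

omit [Group 𝒢] in
/-- **All components `2^{r+1}`-divisible ⟹ the fixed sum is `2`-divisible** (`A` without `2`-torsion). [folklore] -/
theorem exists_two_smul_eq_fixSum_of_forall_components [Monoid 𝒢] (act : 𝒢 →* AddMonoid.End A)
    (htors : ∀ Q : A, (2 : ℤ) • Q = 0 → Q = 0) (G : Finset 𝒢) (P : Finset ℕ) (fix : ℕ → 𝒢 → Prop)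
    [∀ ℓ g, Decidable (fix ℓ g)] (y : A)
    (hdiv : ∀ M ∈ P.powerset, ∃ Q : A, ((2 : ℤ) ^ (P.card + 1)) • Q =
      ∑ g ∈ G, (∏ ℓ ∈ M, (if fix ℓ g then (1 : ℤ) else -1)) • act g y) :
    ∃ Q : A, (2 : ℤ) • Q = ∑ g ∈ G.filter (fun g ↦ ∀ ℓ ∈ P, fix ℓ g), act g y := by
  choose! Q hQ using hdiv
  refine ⟨∑ M ∈ P.powerset, Q M, ?_⟩
  have hsum : ((2 : ℤ) ^ P.card) • ∑ g ∈ G.filter (fun g ↦ ∀ ℓ ∈ P, fix ℓ g), act g y =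
      ((2 : ℤ) ^ P.card) • ((2 : ℤ) • ∑ M ∈ P.powerset, Q M) := by
    rw [two_pow_smul_fixSum_eq_sum_components, smul_smul, ← pow_succ, Finset.smul_sum]
    exact Finset.sum_congr rfl fun M hM ↦ (hQ M hM).symm
  have h0 : ((2 : ℤ) ^ P.card) • ((2 : ℤ) • ∑ M ∈ P.powerset, Q M -
      ∑ g ∈ G.filter (fun g ↦ ∀ ℓ ∈ P, fix ℓ g), act g y) = 0 := by
    rw [smul_sub, hsum, sub_self]
  exact sub_eq_zero.mp (eq_zero_of_two_pow_smul_eq_zero htors _ _ h0)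

omit [Group 𝒢] in
/-- **All components but `Y_{M₀}` are `2^{r+1}`-divisible ⟹ (fixed sum `2`-divisible ⟺ `Y_{M₀}` is `2^{r+1}`-divisible)** (`A` without
`2`-torsion; no «gluing» enters). [folklore] -/
theorem exists_two_smul_eq_fixSum_iff_of_forall_ne [Monoid 𝒢] (act : 𝒢 →* AddMonoid.End A)
    (htors : ∀ Q : A, (2 : ℤ) • Q = 0 → Q = 0) (G : Finset 𝒢) (P : Finset ℕ) (fix : ℕ → 𝒢 → Prop)
    [∀ ℓ g, Decidable (fix ℓ g)] (y : A)
    {M₀ : Finset ℕ} (hM₀ : M₀ ∈ P.powerset)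
    (hdiv : ∀ M ∈ P.powerset, M ≠ M₀ → ∃ Q : A, ((2 : ℤ) ^ (P.card + 1)) • Q =
      ∑ g ∈ G, (∏ ℓ ∈ M, (if fix ℓ g then (1 : ℤ) else -1)) • act g y) :
    (∃ Q : A, (2 : ℤ) • Q = ∑ g ∈ G.filter (fun g ↦ ∀ ℓ ∈ P, fix ℓ g), act g y) ↔
      ∃ Q : A, ((2 : ℤ) ^ (P.card + 1)) • Q = ∑ g ∈ G, (∏ ℓ ∈ M₀, (if fix ℓ g then (1 : ℤ) else -1)) • act g y := by
  -- `2^r Z = Y_{M₀} + 2^{r+1} R`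
  have hdiv' : ∀ M ∈ P.powerset.erase M₀, ∃ Q : A, ((2 : ℤ) ^ (P.card + 1)) • Q =
      ∑ g ∈ G, (∏ ℓ ∈ M, (if fix ℓ g then (1 : ℤ) else -1)) • act g y :=
    fun M hM ↦ hdiv M (Finset.mem_of_mem_erase hM) (Finset.ne_of_mem_erase hM)
  choose! Q hQ using hdiv'
  set Z := ∑ g ∈ G.filter (fun g ↦ ∀ ℓ ∈ P, fix ℓ g), act g y with hZ
  set Y₀ := ∑ g ∈ G, (∏ ℓ ∈ M₀, (if fix ℓ g then (1 : ℤ) else -1)) • act g y with hY₀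
  set R := ∑ M ∈ P.powerset.erase M₀, Q M with hR
  have hdec : ((2 : ℤ) ^ P.card) • Z = Y₀ + ((2 : ℤ) ^ (P.card + 1)) • R := by
    rw [hZ, two_pow_smul_fixSum_eq_sum_components, ← Finset.add_sum_erase _ _ hM₀, hR, Finset.smul_sum]
    congr 1
    exact Finset.sum_congr rfl fun M hM ↦ (hQ M hM).symm
  constructor
  · rintro ⟨Q₁, hQ₁⟩
    refine ⟨Q₁ - R, ?_⟩
    rw [smul_sub, sub_eq_iff_eq_add, ← hdec, ← hQ₁, smul_smul, ← pow_succ]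
  · rintro ⟨Q₁, hQ₁⟩
    refine ⟨Q₁ + R, ?_⟩
    have h0 : ((2 : ℤ) ^ P.card) • ((2 : ℤ) • (Q₁ + R) - Z) = 0 := by
      rw [smul_sub, smul_smul, ← pow_succ, smul_add, hQ₁, ← hdec, sub_self]
    exact sub_eq_zero.mp (eq_zero_of_two_pow_smul_eq_zero htors _ _ h0)

end Abstract

/-! ## §3 The Heegner frame: `2^r · Z_n = Σ_M Y_M` in `E(K[n])` and the composite-level criteria for `P(n)` -/

section Heegner

variable {W : WeierstrassCurve ℚ} [NeZero (W.conductorNorm ℤ)] {K : Type} [Field K] [NumberField K]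
  {Dt : ModularParametrizationData W (W.conductorNorm ℤ)} {β : ℤ} {ι : K →+* ℂ}

/-- **`2^r · Z_n = Σ_{M ⊆ {ℓ∣n}} Y_M` in `E(K[n])`**: for a datum `d` of conductor `n`, radicals `θ_ℓ ∈ K[n]`, a finite `G`
enumerating `𝒢_n = Gal(K[n]/K)`, with `T = {g ∈ G : gθ_ℓ = θ_ℓ ∀ ℓ ∣ n}` and `Y_M = Σ_{g∈G} χ_M(g) g·y(n)`,
`χ_M(g) = ∏_{ℓ∈M}(±1)`: `2^{#{ℓ∣n}} · Σ_{g∈T} g·y(n) = Σ_M Y_M`. (Needs nothing about `E`, `K` or `n`.)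
[cite: GrossLMS1991, §3 (3.5), §4 (4.1)] [cite: SilvermanAEC2009, X.2 Prop. 2.4 (proof)] -/
theorem heegner_two_pow_smul_multiGenusTrace_eq_sum_genusComponents {n : ℕ} (d : KolyvaginHeegnerData Dt β ι n)
    (θ : ℕ → ringClassField K ι n) (G : Finset (ringClassField K ι n ≃ₐ[ℚ] ringClassField K ι n)) :
    ((2 : ℤ) ^ n.primeFactors.card) •
        ∑ g ∈ G.filter (fun g ↦ ∀ ℓ ∈ n.primeFactors, g (θ ℓ) = θ ℓ), pointGalHom W (ringClassField K ι n) g d.y =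
      ∑ M ∈ n.primeFactors.powerset, ∑ g ∈ G,
        (∏ ℓ ∈ M, (if g (θ ℓ) = θ ℓ then (1 : ℤ) else -1)) • pointGalHom W (ringClassField K ι n) g d.y :=
  two_pow_smul_fixSum_eq_sum_components (pointGalHom W (ringClassField K ι n)) G n.primeFactors (fun ℓ g ↦ g (θ ℓ) = θ ℓ) d.y

/-- **(R1)-mechanism at composite level: every genus component `2^{r+1}`-divisible ⟹ `P(n) ∈ 2E(K[n])`.** For `W` globally minimal
with `ρ̄_{E,2}` onto, `K` imaginary quadratic with odd `d_K ≠ −3` and the Heegner hypothesis, `n` square-free of Kolyvagin primes at `2`,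
a datum `d` of conductor `n`, radicals `θ_ℓ² = ℓ*` in `K[n]`, and `G` enumerating `Gal(K[n]/K)`: if for EVERY `M ⊆ {ℓ∣n}` the
genus-character point `Y_M = Σ_{g∈G} χ_M(g) g·y(n)` lies in `2^{r+1}E(K[n])` (`r = #{ℓ∣n}`), then the Kolyvagin derived point `P(n)`
is `2`-divisible — the level `n` certifies nothing for the crux. (`2^r Z_n = Σ Y_M`, `E(K[n])[2] = 0`, and `P(n) ∈ 2E ⟺ Z_n ∈ 2E`.)
[cite: GrossLMS1991, §3 (3.5), Prop. 3.7 (1), §4 (4.1), Lemma 4.3] [cite: McCallumLMS1991, §5] -/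
theorem heegner_exists_two_zsmul_eq_derivedPoint_of_forall_genusComponents [W.IsElliptic] [W.IsGloballyMinimal]
    (hK : IsImaginaryQuadratic K) (hodd : Odd (NumberField.discr K)) (h3 : NumberField.discr K ≠ -3)
    (hH : SatisfiesHeegnerHypothesis (W.conductorNorm ℤ) K) (hsurj : W.HasSurjectiveModNGaloisRep ((2 : ℤ) ^ 1))
    {n : ℕ} (hn : Squarefree n) (hKoly : ∀ ℓ ∈ n.primeFactors, Zhang2014.IsKolyvaginPrime (W.conductorNorm ℤ) W K 2 ℓ)
    (d : KolyvaginHeegnerData Dt β ι n) {θ : ℕ → ringClassField K ι n}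
    (hθ : ∀ ℓ ∈ n.primeFactors, θ ℓ ^ 2 = algebraMap ℚ (ringClassField K ι n) ((-1 : ℚ) ^ (ℓ / 2) * ℓ))
    (G : Finset (ringClassField K ι n ≃ₐ[ℚ] ringClassField K ι n)) (hG : ∀ g, g ∈ G ↔ g ∈ ringClassGal ι n)
    (hdiv : ∀ M ∈ n.primeFactors.powerset, ∃ Q : (W.baseChange (ringClassField K ι n)).toAffine.Point,
      ((2 : ℤ) ^ (n.primeFactors.card + 1)) • Q =
        ∑ g ∈ G, (∏ ℓ ∈ M, (if g (θ ℓ) = θ ℓ then (1 : ℤ) else -1)) • pointGalHom W (ringClassField K ι n) g d.y) :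
    ∃ Q : (W.baseChange (ringClassField K ι n)).toAffine.Point, (2 : ℤ) • Q = d.derivedPoint := by
  have htors := heegner_two_torsion_free (ι := ι) hK hodd hH hsurj hn.ne_zero
  have hT : ∀ g, g ∈ G.filter (fun g ↦ ∀ ℓ ∈ n.primeFactors, g (θ ℓ) = θ ℓ) ↔
      g ∈ ringClassGal ι n ∧ ∀ ℓ ∈ n.primeFactors, g (θ ℓ) = θ ℓ := fun g ↦ by
    rw [Finset.mem_filter, hG]
  rw [heegner_exists_two_zsmul_eq_derivedPoint_iff_multiGenusTrace hK (discr_lt_neg_four_of_odd hK hodd h3) hH hn hKoly d hθ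
    _ hT]
  exact exists_two_smul_eq_fixSum_of_forall_components (pointGalHom W (ringClassField K ι n)) htors G n.primeFactors
    (fun ℓ g ↦ g (θ ℓ) = θ ℓ) d.y hdiv

/-- **(R2)-mechanism at composite level: all genus components but one `2^{r+1}`-divisible ⟹ (`P(n) ∈ 2E(K[n]) ⟺` that component is
`2^{r+1}`-divisible).** Same frame; `M₀ ⊆ {ℓ∣n}` the exceptional index. So a level `n` whose components other than `Y_{M₀}` are deep
enough certifies the crux EXACTLY when `Y_{M₀} ∉ 2^{r+1}E(K[n])` — an exact-`2`-adic-index statement about ONE genus-character Heegner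
point (the Gross–Zagier datum of the genus twist `E^{(m₀*)}/K`, up to the norm-relation factor `A(n/m₀)`); no gluing between
eigen-lattices enters this direction. [cite: GrossLMS1991, §3 (3.5), Prop. 3.7 (1), §4 (4.1), Lemma 4.3] [cite: McCallumLMS1991, §5] -/
theorem heegner_exists_two_zsmul_eq_derivedPoint_iff_genusComponent [W.IsElliptic] [W.IsGloballyMinimal]
    (hK : IsImaginaryQuadratic K) (hodd : Odd (NumberField.discr K)) (h3 : NumberField.discr K ≠ -3)
    (hH : SatisfiesHeegnerHypothesis (W.conductorNorm ℤ) K) (hsurj : W.HasSurjectiveModNGaloisRep ((2 : ℤ) ^ 1))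
    {n : ℕ} (hn : Squarefree n) (hKoly : ∀ ℓ ∈ n.primeFactors, Zhang2014.IsKolyvaginPrime (W.conductorNorm ℤ) W K 2 ℓ)
    (d : KolyvaginHeegnerData Dt β ι n) {θ : ℕ → ringClassField K ι n}
    (hθ : ∀ ℓ ∈ n.primeFactors, θ ℓ ^ 2 = algebraMap ℚ (ringClassField K ι n) ((-1 : ℚ) ^ (ℓ / 2) * ℓ))
    (G : Finset (ringClassField K ι n ≃ₐ[ℚ] ringClassField K ι n)) (hG : ∀ g, g ∈ G ↔ g ∈ ringClassGal ι n)
    {M₀ : Finset ℕ} (hM₀ : M₀ ∈ n.primeFactors.powerset)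
    (hdiv : ∀ M ∈ n.primeFactors.powerset, M ≠ M₀ → ∃ Q : (W.baseChange (ringClassField K ι n)).toAffine.Point,
      ((2 : ℤ) ^ (n.primeFactors.card + 1)) • Q =
        ∑ g ∈ G, (∏ ℓ ∈ M, (if g (θ ℓ) = θ ℓ then (1 : ℤ) else -1)) • pointGalHom W (ringClassField K ι n) g d.y) :
    (∃ Q : (W.baseChange (ringClassField K ι n)).toAffine.Point, (2 : ℤ) • Q = d.derivedPoint) ↔
      ∃ Q : (W.baseChange (ringClassField K ι n)).toAffine.Point, ((2 : ℤ) ^ (n.primeFactors.card + 1)) • Q =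
        ∑ g ∈ G, (∏ ℓ ∈ M₀, (if g (θ ℓ) = θ ℓ then (1 : ℤ) else -1)) • pointGalHom W (ringClassField K ι n) g d.y := by
  have htors := heegner_two_torsion_free (ι := ι) hK hodd hH hsurj hn.ne_zero
  have hT : ∀ g, g ∈ G.filter (fun g ↦ ∀ ℓ ∈ n.primeFactors, g (θ ℓ) = θ ℓ) ↔
      g ∈ ringClassGal ι n ∧ ∀ ℓ ∈ n.primeFactors, g (θ ℓ) = θ ℓ := fun g ↦ by
    rw [Finset.mem_filter, hG]
  rw [heegner_exists_two_zsmul_eq_derivedPoint_iff_multiGenusTrace hK (discr_lt_neg_four_of_odd hK hodd h3) hH hn hKoly d hθ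
    _ hT]
  exact exists_two_smul_eq_fixSum_iff_of_forall_ne (pointGalHom W (ringClassField K ι n)) htors G n.primeFactors
    (fun ℓ g ↦ g (θ ℓ) = θ ℓ) d.y hM₀ hdiv

/-- **`Gal(K[n]/K)` is enumerable**: a finite `G` with `g ∈ G ↔ g ∈ 𝒢_n` exists (`K[n]` is a number field). [folklore] -/
theorem heegner_exists_finset_ringClassGal (hK : IsImaginaryQuadratic K) {n : ℕ} (hn : n ≠ 0) :
    ∃ G : Finset (ringClassField K ι n ≃ₐ[ℚ] ringClassField K ι n), ∀ g, g ∈ G ↔ g ∈ ringClassGal ι n := by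
  haveI : NumberField (ringClassField K ι n) := numberField_ringClassField hK ι hn
  exact ⟨Finset.univ.filter (fun g ↦ g ∈ ringClassGal ι n), fun g ↦ by simp⟩

end Heegner

/-! ## §4 (APPEND, same seat g3) ISOTYPY: `h · Y_M = χ_M(h) · Y_M` for `h ∈ 𝒢_n`, and isotypic descent of `2^k`-th roots -/

section AbstractIsotypy

variable {𝒢 : Type*} [Group 𝒢] {A : Type*} [AddCommGroup A]

/-- Sign bookkeeping: if `fix (h g) ↔ (fix h ↔ fix g)` then `sign(h⁻¹ g') = sign(h) · sign(g')`. [folklore] -/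
theorem sign_inv_mul_eq (fix : 𝒢 → Prop) [∀ g, Decidable (fix g)] {h g' : 𝒢}
    (hmul : fix (h * (h⁻¹ * g')) ↔ (fix h ↔ fix (h⁻¹ * g'))) :
    (if fix (h⁻¹ * g') then (1 : ℤ) else -1) = (if fix h then (1 : ℤ) else -1) * (if fix g' then (1 : ℤ) else -1) := by
  rw [mul_inv_cancel_left] at hmul
  by_cases h1 : fix h <;> by_cases h2 : fix g' <;> by_cases h3 : fix (h⁻¹ * g') <;> simp_all

/-- **Isotypy of a character component (abstract)**: for a finite `G` enumerating a subgroup `H`, a «fixes» predicate that is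
multiplicative in the sense `fix_ℓ(hg) ↔ (fix_ℓ h ↔ fix_ℓ g)` on `H`, and `h ∈ H`:
`h · Σ_{g∈G} χ_M(g) g·y = χ_M(h) · Σ_{g∈G} χ_M(g) g·y` (reindex `g ↦ hg`). [folklore] -/
theorem act_component_eq_sign_smul (act : 𝒢 →* AddMonoid.End A) (H : Subgroup 𝒢) (G : Finset 𝒢)
    (hG : ∀ g, g ∈ G ↔ g ∈ H) (M : Finset ℕ) (fix : ℕ → 𝒢 → Prop) [∀ ℓ g, Decidable (fix ℓ g)]
    (hmul : ∀ ℓ ∈ M, ∀ h ∈ H, ∀ g ∈ H, (fix ℓ (h * g) ↔ (fix ℓ h ↔ fix ℓ g))) (y : A) {h : 𝒢} (hh : h ∈ H) :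
    act h (∑ g ∈ G, (∏ ℓ ∈ M, (if fix ℓ g then (1 : ℤ) else -1)) • act g y) =
      (∏ ℓ ∈ M, (if fix ℓ h then (1 : ℤ) else -1)) • ∑ g ∈ G, (∏ ℓ ∈ M, (if fix ℓ g then (1 : ℤ) else -1)) • act g y := by
  rw [map_sum]
  -- reindex `g ↦ h * g`
  have hre : ∑ g ∈ G, act h ((∏ ℓ ∈ M, (if fix ℓ g then (1 : ℤ) else -1)) • act g y) =
      ∑ g' ∈ G, (∏ ℓ ∈ M, (if fix ℓ (h⁻¹ * g') then (1 : ℤ) else -1)) • act g' y := by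
    refine Finset.sum_nbij (fun g ↦ h * g) (fun g hg ↦ (hG _).mpr (H.mul_mem hh ((hG g).mp hg)))
      (fun a _ b _ hab ↦ mul_left_cancel hab) (fun g' hg' ↦ ⟨h⁻¹ * g', ?_, ?_⟩) (fun g _ ↦ ?_)
    · exact (hG _).mpr (H.mul_mem (H.inv_mem hh) ((hG g').mp hg'))
    · simp
    · rw [map_zsmul, inv_mul_cancel_left, map_mul]
      rfl
  rw [hre, Finset.smul_sum]
  refine Finset.sum_congr rfl fun g' hg' ↦ ?_
  rw [smul_smul, ← Finset.prod_mul_distrib]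
  congr 1
  refine Finset.prod_congr rfl fun ℓ hℓ ↦ ?_
  exact sign_inv_mul_eq (fix ℓ) (hmul ℓ hℓ h hh (h⁻¹ * g') (H.mul_mem (H.inv_mem hh) ((hG g').mp hg')))

/-- **Isotypic descent of roots (abstract)**: if `h · Y = ε · Y` (`ε = ±1`), `2^k · R = Y` and `A` has no `2`-torsion, then
`h · R = ε · R`. [folklore] -/
theorem act_root_eq_sign_smul (act : 𝒢 →* AddMonoid.End A) (htors : ∀ Q : A, (2 : ℤ) • Q = 0 → Q = 0) {h : 𝒢} {Y R : A}
    {ε : ℤ} {k : ℕ} (hY : act h Y = ε • Y) (hR : ((2 : ℤ) ^ k) • R = Y) : act h R = ε • R := by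
  have h0 : ((2 : ℤ) ^ k) • (act h R - ε • R) = 0 := by
    rw [smul_sub, ← map_zsmul, hR, hY, smul_comm, hR, sub_self]
  exact sub_eq_zero.mp (eq_zero_of_two_pow_smul_eq_zero htors k _ h0)

end AbstractIsotypy

section HeegnerIsotypy

variable {W : WeierstrassCurve ℚ} [NeZero (W.conductorNorm ℤ)] {K : Type} [Field K] [NumberField K]
  {Dt : ModularParametrizationData W (W.conductorNorm ℤ)} {β : ℤ} {ι : K →+* ℂ}

omit [NeZero (W.conductorNorm ℤ)] in
/-- Multiplicativity of «fixes `θ`» for automorphisms moving `θ` to `±θ` (`θ² ∈ ℚ`, `θ ≠ 0`). [cite: SilvermanAEC2009, X.2 Prop. 2.4 (proof)] -/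
theorem heegner_fix_mul_iff {n : ℕ} {θ : ringClassField K ι n} {q : ℚ}
    (hθ2 : θ ^ 2 = algebraMap ℚ (ringClassField K ι n) q) (hθ0 : θ ≠ 0)
    (h g : ringClassField K ι n ≃ₐ[ℚ] ringClassField K ι n) : (h * g) θ = θ ↔ (h θ = θ ↔ g θ = θ) := by
  haveI : CharZero (ringClassField K ι n) :=
    charZero_of_injective_algebraMap (algebraMap ℚ (ringClassField K ι n)).injective
  have hne : θ ≠ -θ := ne_neg_of_ne_zero hθ0
  have hne' : -θ ≠ θ := fun e ↦ hne e.symm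
  rw [AlgEquiv.mul_apply]
  rcases algEquiv_apply_eq_or_eq_neg_of_sq_eq hθ2 g with hg | hg <;>
    rcases algEquiv_apply_eq_or_eq_neg_of_sq_eq hθ2 h with hh | hh <;>
    simp [hg, hh, map_neg, hne']

/-- **THE GENUS-CHARACTER POINTS ARE ISOTYPIC**: for any level `n`, radicals `θ_ℓ² = ℓ*` in `K[n]`,
`G` enumerating `𝒢_n = Gal(K[n]/K)`, `M ⊆ {ℓ ∣ n}` and `h ∈ 𝒢_n`:
`h · Y_M = χ_M(h) · Y_M`, `χ_M(h) = ∏_{ℓ∈M} (hθ_ℓ/θ_ℓ)` — `Y_M ∈ E(K[n])^{χ_M}`, the `χ_M`-part, i.e. (up to the twist isomorphism) a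
point of the genus twist `E^{(m*)}` over `K`, `m = ∏ M`. Composite-level form of `…GenusCharacter.heegner_genusCharacterPoint_isotypic`.
[cite: GrossLMS1991, §3 (3.5), §4 (4.1)] [cite: SilvermanAEC2009, X.2 Prop. 2.4 (proof)] -/
theorem heegner_genusComponent_isotypic {n : ℕ} (d : KolyvaginHeegnerData Dt β ι n) {θ : ℕ → ringClassField K ι n}
    (hθ : ∀ ℓ ∈ n.primeFactors, θ ℓ ^ 2 = algebraMap ℚ (ringClassField K ι n) ((-1 : ℚ) ^ (ℓ / 2) * ℓ))
    (G : Finset (ringClassField K ι n ≃ₐ[ℚ] ringClassField K ι n)) (hG : ∀ g, g ∈ G ↔ g ∈ ringClassGal ι n)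
    {M : Finset ℕ} (hM : M ∈ n.primeFactors.powerset)
    {h : ringClassField K ι n ≃ₐ[ℚ] ringClassField K ι n} (hh : h ∈ ringClassGal ι n) :
    pointGalHom W (ringClassField K ι n) h
        (∑ g ∈ G, (∏ ℓ ∈ M, (if g (θ ℓ) = θ ℓ then (1 : ℤ) else -1)) • pointGalHom W (ringClassField K ι n) g d.y) =
      (∏ ℓ ∈ M, (if h (θ ℓ) = θ ℓ then (1 : ℤ) else -1)) •
        ∑ g ∈ G, (∏ ℓ ∈ M, (if g (θ ℓ) = θ ℓ then (1 : ℤ) else -1)) • pointGalHom W (ringClassField K ι n) g d.y := by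
  refine act_component_eq_sign_smul (pointGalHom W (ringClassField K ι n)) (ringClassGal ι n) G hG M
    (fun ℓ g ↦ g (θ ℓ) = θ ℓ) (fun ℓ hℓ h' _ g _ ↦ ?_) d.y hh
  have hℓ : ℓ ∈ n.primeFactors := Finset.mem_powerset.mp hM hℓ
  exact heegner_fix_mul_iff (hθ ℓ hℓ) (ne_zero_of_sq_eq_pStar (Nat.prime_of_mem_primeFactors hℓ) (hθ ℓ hℓ)) h' g

/-- **Isotypic descent**: on the crux's frame (`ρ̄_{E,2}` onto, odd `d_K`, Heegner hypothesis, `n ≠ 0` square-free of Kolyvagin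
primes at `2`), a `2^k`-th root `R` of the genus-character point `Y_M` in `E(K[n])` is itself `χ_M`-isotypic: `h · R = χ_M(h) · R` for
every `h ∈ 𝒢_n`. So every divisibility test on `Y_M` (§3) lives inside the `χ_M`-lattice `E(K[n])^{χ_M} ≅ E^{(m*)}(K)`.
[cite: GrossLMS1991, §4, Lemma 4.3] [cite: SilvermanAEC2009, X.2 Prop. 2.4 (proof)] -/
theorem heegner_genusComponent_root_isotypic [W.IsElliptic] [W.IsGloballyMinimal] (hK : IsImaginaryQuadratic K)
    (hodd : Odd (NumberField.discr K)) (hH : SatisfiesHeegnerHypothesis (W.conductorNorm ℤ) K)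
    (hsurj : W.HasSurjectiveModNGaloisRep ((2 : ℤ) ^ 1)) {n : ℕ} (hn : n ≠ 0)
    (d : KolyvaginHeegnerData Dt β ι n) {θ : ℕ → ringClassField K ι n}
    (hθ : ∀ ℓ ∈ n.primeFactors, θ ℓ ^ 2 = algebraMap ℚ (ringClassField K ι n) ((-1 : ℚ) ^ (ℓ / 2) * ℓ))
    (G : Finset (ringClassField K ι n ≃ₐ[ℚ] ringClassField K ι n)) (hG : ∀ g, g ∈ G ↔ g ∈ ringClassGal ι n)
    {M : Finset ℕ} (hM : M ∈ n.primeFactors.powerset) {k : ℕ} {R : (W.baseChange (ringClassField K ι n)).toAffine.Point}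
    (hR : ((2 : ℤ) ^ k) • R =
      ∑ g ∈ G, (∏ ℓ ∈ M, (if g (θ ℓ) = θ ℓ then (1 : ℤ) else -1)) • pointGalHom W (ringClassField K ι n) g d.y)
    {h : ringClassField K ι n ≃ₐ[ℚ] ringClassField K ι n} (hh : h ∈ ringClassGal ι n) :
    pointGalHom W (ringClassField K ι n) h R = (∏ ℓ ∈ M, (if h (θ ℓ) = θ ℓ then (1 : ℤ) else -1)) • R :=
  act_root_eq_sign_smul (pointGalHom W (ringClassField K ι n))
    (heegner_two_torsion_free (ι := ι) hK hodd hH hsurj hn) (heegner_genusComponent_isotypic d hθ G hG hM hh) hR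

end HeegnerIsotypy

end Summit.BirchSwinnertonDyer.BirchSwinnertonDyer.Theorems.GenusKoly

end
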